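import Summits.CriticalPhenomena.SAWScalingLimit.Theses.SAWHexUniversality
import Summits.CriticalPhenomena.SAWScalingLimit.Theses.SAWDefectDecoherence
import Summits.CriticalPhenomena.SAWScalingLimit.Theorems.HexConjecture.Negative.BoundaryWitness
import Literature.Probability.RandomPlanarGeometry.HullRestrictionSLEHolds
import Literature.Probability.RandomPlanarGeometry.SAWSideProbability

/-!
# Line `root-locality-replaces-loewner` — crux `HexConjecture` (stmt-CriticalPhenomena-0808; decl `SAWHexUniversality.HexConjecture` = `SAWDefectDecoherence.HexConjecture`, shared by 4 routes)

Skeleton of the line (crux-plan, planner-cruxplan-stmt-CriticalPhenomena-0808-root-locality-replac-0,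
2026-08-16) for the crux idea `Ideas/root-locality-replaces-loewner.md` (crux-ideate r1, ideator 2;
triage r1: 3 × pass, mandatory sharpening "∃ r → ∀ r" of `RootDominance` APPLIED below, dependency
warning "consume the REPAIRED Conj. 2" APPLIED below).

THE CRUX (fixed; the route decl, shared by 4 routes): Duminil-Copin–Smirnov 2012 Conjecture 1 on the
honeycomb lattice — for every Dobrushin domain `(D; a, b)` and every hexagonal endpoint approximation
(`IsEmbEndpointApprox hexGraph hexCenter D a b`: eventually joined in `Ω_δ`, `δ·a_δ → a`, `δ·b_δ → b`)
the critical SAW law `hexSAWLaw` on `Ω_δ`, pushed to `CurveClass ℂ`, converges in law to chordal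
SLE_{8/3} (`ConvergesInLawToSLE (8/3)`).

THE LINE. Replace the Loewner/martingale identification (`ObservableToSLER`: Conj. 2 in the walk's own
slit domains + tightness) by RESTRICTION: the `x_c`-weighted SAW has EXACT lattice restriction
covariance, so the probability that the walk of `Ω` stays inside a hull subdomain `Ω' = Ω ∖ A` is a
ratio `Z_{Λ'}(a,b)/Z_Λ(a,b)` of two boundary values of ONE parafermionic observable in two domains.
Conj. 2 in its repaired, `b`-normalised form (`HexObservableLimitR`, stmt-14003: flat horizontal
half-lattice pieces pinned at BOTH marks) applied in `Ω` and in `Ω'` gives this ratio UP TO the one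
scalar it cannot see (the absolute size of `F` at its root); ROOT DOMINANCE (`stub_rootDominance`, the
lever: `ψ`-averages of `F` next to the root `a` do not feel the far-away change `Λ ↦ Λ'`, relative
error `→ 0` as `supp ψ → a`) supplies exactly that scalar, and the computation
`F'(b)/F(b) = (S'/S)·I_Ω(ψ)/I_{Ω'}(ψ)·(1+o(1))`, `I_Ω/I_{Ω'} → (h'(0)/h'(∞))^{5/8} = Φ_A'(0)^{5/8}`
(`φ_{Ω'} = h ∘ φ_Ω`, `h : ℍ ∖ Ã → ℍ`, `a ↦ ∞`, `b ↦ 0`; re-derived by all three triagers) yields the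
AVOIDANCE COCYCLE WITH THE LAWLER–SCHRAMM–WERNER VALUE (`stub_avoidanceCocycle`). From there the
range of the walk is identified as the SLE_{8/3} trace by the restriction facts PROVED in the tree
(`sle_restriction_eightThirds_holds`, `IsSLELaw.hullRestriction_eightThirds_holds`,
`RestrictionConfig.ext_of_avoid_holds`, `LawlerSchrammWerner2003_unique_holds`) plus compactness
of the hyperspace `NonemptyCompacts` — no tightness input (`stub_rangeIdentification`); ONE SAW
regularity estimate, NON-RETRACING (no three pairwise `ε`-close disjoint sub-walks of diameter `≥ ℓ`,
`stub_nonRetracing`), upgrades range convergence to curve convergence by an ABSTRACT topological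
lemma (`stub_curveUpgrade`, all curve families; tightness and simplicity become OUTPUTS). All of this
happens in the class where the observable input lives: `D` flat near both marks, lattice endpoints =
discrete-boundary vertices (the printed reading of DCS). The passage to ALL Dobrushin domains and
ALL `IsEmbEndpointApprox` endpoints (rough marks; microscopically interior endpoints — the
disprover's near-miss `Boundary.HexConjectureBoundaryEndpoints`) is the FOREIGN residual
`stub_marksAndEndpoints`, shared with every observable route (it is the converse direction of
`Boundary.boundaryEndpoints_of_hexConjecture`; this line does not attack it).

STUBS (7, registered; `sorry` only inside them; `HexConjecture_of` composes them into the crux BY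
NAME, kernel-checked; `hexConjectureFlatBoundary_of_line` is the kernel-checked REACH of stubs 1–6
without the foreign stub):
1. `stub_observableLimit`     — `HexObservableLimitR` verbatim (shared target stmt-14003 of the route;
   DCS Conj. 2 repaired; XL, OPEN; not this line's to attack).
2. `stub_rootDominance`       — ROOT DOMINANCE (the LEVER; L–XL, OPEN; hardest stub OF THE LINE).
3. `stub_avoidanceCocycle`    — 1 → 2 → `HexAvoidanceCocycle` (L: the computation + winding rigidity
   at `b` + LSW Thm 6.1 value + exact lattice restriction + canonical-discretisation transfer).
4. `stub_rangeIdentification` — cocycle → range of the walk converges in law (Hausdorff metric) to the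
   SLE_{8/3} range (M–L, provable now: restriction uniqueness, hyperspace compactness, filling).
5. `stub_nonRetracing`        — no `(ε, ℓ)`-triple strands, `ε → 0` after `δ → 0` (L–XL, OPEN SAW
   estimate; second-hardest).
6. `stub_curveUpgrade`        — ABSTRACT: range convergence to an SLE_{8/3} curve + endpoints +
   non-retracing in law ⟹ `ConvergesInLawToSLE (8/3)` (M, provable now, pure topology/measure).
7. `stub_marksAndEndpoints`   — `HexConjectureFlatBoundary → HexConjecture` (XL, FOREIGN residual).

## Disproof used
The standing `Disproof.lean` (cdisprove gen2 v5, `run/gate/evidence/stmt-CriticalPhenomena-0808/…`)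
is NOT mounted in this planner jail and is not published under `Cruxes/HexConjecture/` (`ledger crux
ls`); used through the LANDED negative files, imported here:
* `Negative.hexConjecture_false_without_tendsto_fst / _snd / _reachable` (LoadBearing.lean: every
  clause of `IsEmbEndpointApprox` is load-bearing) — HONOURED: no stub drops a clause; the line USES
  `tendsto_fst`/`tendsto_snd` at `stub_curveUpgrade` (orientation of the limit arc: `src δ → D.pt 0`,
  `tgt δ → D.pt 1`, fed by `IsEmbEndpointApprox.tendsto_fst/snd` in `hexConjectureFlatBoundary_of_line`)
  and `reachable` at `stub_rangeIdentification`/`stub_avoidanceCocycle` (the laws are probability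
  measures eventually; `Negative.hexSAWLaw_eq_zero_of_not_mem` is the junk they exclude).
* `Boundary.HexConjectureBoundaryEndpoints`, `Boundary.boundaryEndpoints_of_hexConjecture`
  (BoundaryWitness.lean: the printed, discrete-boundary-endpoint reading is strictly weaker a priori)
  — HONOURED AND NAMED: stubs 3–6 live in that reading (restricted further to flat marks), and the gap
  to the crux is its own registered stub 7 (`flatBoundary_of_boundaryEndpoints` below records that the
  printed reading implies this line's class outright).
* `Boundary.not_forall_isProbabilityMeasure_hexSAWLaw`, `Boundary.hexConjectureAtFugacity_zero_false`
  (refuted strengthenings: all-`δ` probability, fugacity `0`) — no stub is an instance: every law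
  statement is eventual along `𝓝[>] 0` and at `x_c`.
* `ledger negatives --problem CriticalPhenomena` (8 items): stmt-5420 `HexObservableLimit` (corridor
  witness) — the line consumes the REPAIRED stmt-14003 (root pinned: rigid half-lattice in the ball at
  `a` as at `b`) and `RootDominance` copies the same rigid half-lattice clause in the root ball and is
  RELATIVE (`Λ`, `Λ'` agree in the ball; triage r1-2/3: "immune to the corridor witness"); stmt-0772
  (all-`δ` tightness `IsTightLaws`) — no tightness statement anywhere, everything eventual; stmt-8312 /
  8261 — no phase retrieval, no positive-definiteness.
-/

noncomputable section

namespace Summit.CriticalPhenomena.SAWScalingLimit.Cruxes.HexConjecture.RootLocalityReplacesLoewner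

open scoped Topology NNReal ENNReal
open Filter Set MeasureTheory
open Literature.Probability.RandomPlanarGeometry Literature.Probability.RandomPlanarGeometry.SAW
open Literature.Probability.LatticeModels

/-! ## The statements (named `Prop`s over tree declarations; the registered `stub_*` theorems restate
them verbatim, fully qualified; `Registered.stub_*` are the name-keyed aliases taken as hypotheses of
`HexConjecture_of` — same device as `Lines/critical-kloosterman-powerful-moduli.lean` of crux
`MazurKaneLaw`: the skeleton audit admits a hypothesis whose head's last name component is a
declared stub)

Standing "flat-boundary class" hypotheses, inlined in statements 3–5 and 7 (the class in which the
observable input `HexObservableLimitR` lives): `0 < ρ`; for BOTH marked points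
`D ∩ B(pt i, ρ) = {im z > im (pt i)} ∩ B(pt i, ρ)` (horizontal half-plane pieces, as in stmt-14003);
`IsEmbEndpointApprox hexGraph hexCenter D a b`; and eventually `a δ`, `b δ` are DISCRETE-BOUNDARY
vertices of `Ω_δ` (verbatim the body of `Boundary.IsDiscreteBoundaryVertex`: in `Ω_δ` with a honeycomb
neighbour to which the `Ω_δ`-edge is missing; inside the flat balls these are exactly the bottom
zigzag up-faces, resp. the dangling down-faces, of the half-lattice — DCS's "vertices of `Ω_δ` closest
to `a`, `b`"). -/

/-- An `(ε, ℓ)`-TRIPLE STRAND of a curve class: some representative has three pairwise disjoint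
parameter intervals, in order, whose images have diameter `≥ ℓ` and are pairwise within Hausdorff
distance `ε`. Reparametrisation-invariant. Its negation along the walk ("non-retracing") is the one
regularity input of the line (`HexNonRetracing`); a macroscopic parameter backtrack along a simple arc
forces one (`CurveUpgrade`). Inlined verbatim in the registered signatures. -/
def HasTripleStrand (γ : CurveClass ℂ) (ε ℓ : ℝ) : Prop :=
  ∃ c : Curve ℂ, CurveClass.mk c = γ ∧ ∃ s t : Fin 3 → unitInterval,
    (∀ i, s i ≤ t i) ∧ t 0 < s 1 ∧ t 1 < s 2 ∧
    (∀ i, ℓ ≤ Metric.diam ((⇑c) '' Set.Icc (s i) (t i))) ∧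
    ∀ i j, Metric.hausdorffDist ((⇑c) '' Set.Icc (s i) (t i))
      ((⇑c) '' Set.Icc (s j) (t j)) ≤ ε

/-- STATEMENT 1 — `ObservableLimit`: Duminil-Copin–Smirnov 2012 Conjecture 2 on the honeycomb
lattice, `ψ`-averaged and `b`-normalised, with BOTH marks pinned conformally (flat horizontal
half-lattice pieces in `ρ`-balls) — VERBATIM the body of the route's repaired target
`SAWDefectDecoherence.HexObservableLimitR` (stmt-CriticalPhenomena-14003; `observableLimit_iff`). -/
def ObservableLimit : Prop :=
  ∃ c : ℂ, c ≠ 0 ∧ ∀ (D : Literature.Probability.RandomPlanarGeometry.DobrushinDomain) (ρ : ℝ) (Λ : ℝ → Finset Literature.Probability.LatticeModels.HexVertex) (m : Fin 2 → ℝ → ℤ) (a b : ℝ → Sym2 Literature.Probability.LatticeModels.HexVertex) (Φ : Literature.Probability.RandomPlanarGeometry.ConformalEquiv D.carrier UpperHalfPlane.upperHalfPlaneSet) (L : ℂ → ℂ) (Lb : ℂ) (ψ : ℂ → ℂ), let F : ℝ → Sym2 Literature.Probability.LatticeModels.HexVertex → ℂ := fun δ z => Literature.Probability.RandomPlanarGeometry.SAW.hexParafermionicObservable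 (Λ δ) (a δ) Literature.Probability.RandomPlanarGeometry.SAW.hexCriticalFugacity (5 / 8) z; 0 < ρ → (∀ i : Fin 2, D.carrier ∩ Metric.ball (D.pt i) ρ = {z : ℂ | (D.pt i).im < z.im} ∩ Metric.ball (D.pt i) ρ) → (∀ᶠ δ : ℝ in nhdsWithin 0 (Set.Ioi 0), Literature.Probability.RandomPlanarGeometry.SAW.hexDomainSimplyConnected (Λ δ) ∧ a δ ∈ Literature.Probability.RandomPlanarGeometry.SAW.hexDomainBoundary (Λ δ) ∧ b δ ∈ Literature.Probability.RandomPlanarGeometry.SAW.hexDomainBoundary (Λ δ) ∧ Nonempty (Literature.Probability.RandomPlanarGeometry.SAW.HexMidEdgeSAW (Λ δ) (a δ) (b δ)) ∧ (Literature.Probability.LatticeModels.hexGraph.induce ((Λ δ : Finset Literature.Probability.LatticeModels.HexVertex) : Set Literature.Probability.LatticeModels.HexVertex)).Preconnected ∧ (∀ v ∈ Λ δ, (δ : ℂ) * Literature.Probability.LatticeModels.hexCenter v ∈ D.carrier) ∧ (∀ i : Fin 2, ∀ v : Literature.Probability.LatticeModels.HexVertex, (δ : ℂ) * Literature.Probability.LatticeModels.hexCenter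 v ∈ Metric.ball (D.pt i) ρ → (v ∈ Λ δ ↔ m i δ ≤ v.1 1))) → (∀ K : Set ℂ, IsCompact K → K ⊆ D.carrier → ∀ᶠ δ : ℝ in nhdsWithin 0 (Set.Ioi 0), ∀ v : Literature.Probability.LatticeModels.HexVertex, (δ : ℂ) * Literature.Probability.LatticeModels.hexCenter v ∈ K → v ∈ Λ δ) → Filter.Tendsto (fun δ : ℝ => (δ : ℂ) * Literature.Probability.RandomPlanarGeometry.SAW.hexMidpoint (a δ)) (nhdsWithin 0 (Set.Ioi 0)) (nhds (D.pt 0)) → Filter.Tendsto (fun δ : ℝ => (δ : ℂ) * Literature.Probability.RandomPlanarGeometry.SAW.hexMidpoint (b δ)) (nhdsWithin 0 (Set.Ioi 0)) (nhds (D.pt 1)) → Filter.Tendsto (fun x => ‖Φ x‖) (nhdsWithin (D.pt 0) D.carrier) Filter.atTop → Φ.HasBoundaryValue (D.pt 1) 0 → ContinuousOn L D.carrier → (∀ z ∈ D.carrier, Complex.exp (L z) = deriv Φ z) → Filter.Tendsto L (nhdsWithin (D.pt 1) D.carrier) (nhds Lb) → Continuous ψ → HasCompactSupport ψ → tsupport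 ψ ⊆ D.carrier → Filter.Tendsto (fun δ : ℝ => (δ : ℂ) ^ 2 * (∑ᶠ e ∈ Literature.Probability.RandomPlanarGeometry.SAW.hexDomainMidEdges (Λ δ), ψ ((δ : ℂ) * Literature.Probability.RandomPlanarGeometry.SAW.hexMidpoint e) * F δ e) / F δ (b δ)) (nhdsWithin 0 (Set.Ioi 0)) (nhds (c * ∫ z, ψ z * Complex.exp ((5 / 8 : ℂ) * (L z - Lb))))

/-- The line's statement 1 IS the route item stmt-14003 (definitionally). -/
theorem observableLimit_iff :
    ObservableLimit ↔ Summit.CriticalPhenomena.SAWScalingLimit.Theses.SAWDefectDecoherence.HexObservableLimitR :=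
  Iff.rfl

/-- STATEMENT 2 — `RootDominance` (THE LEVER; sharpened per triage r1-1/2/3: `∀ ε ∃ r₀ ∀ r < r₀ ∃ ψ`,
so `supp ψ → a` jointly with `ε → 0`). Setting = the ROOT half of stmt-14003's: a Dobrushin domain
flat (horizontal half-plane piece) in the ball `B(a, ρ)`, two discretisation families `Λ' δ ⊆ Λ δ`,
both hex-simply-connected, inside `Ω`, with the SAME boundary root mid-edge `a δ` (`δ·a δ → a`), `Λ δ`
the exact half-lattice `{row ≥ m δ}` inside the ball and `Λ' = Λ` inside the ball (the change is far
from the root). Claim: for every `ε > 0` there is a scale `r₀` such that at EVERY scale `r < r₀` some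
nonnegative bump `ψ ≢ 0` supported in the small interior ball `B(a + i r, r/4)` (angular localisation:
the phases of `F` are then coherent, `|I_Ω(ψ)| ≍ ∫ψ|φ'|^{5/8}`) has, eventually as `δ → 0⁺`,
`‖S'_δ − S_δ‖ ≤ ε ‖S_δ‖`, `S_δ = Σ_e ψ(δe) F_{Λ δ}(e)`, `S'_δ` the same sum for `Λ' δ`, `F` the
observable at `x_c`, `σ = 5/8` rooted at `a δ`. Given statement 1 in `Ω` and `Ω'` this is EQUIVALENT
to the avoidance cocycle with the LSW value (module docstring); it is the observable-side form of
"P_Λ(γ ⊆ Λ') → Φ_A'(0)^{5/8}" and carries PHASE content (card: bounding `‖S'−S‖` by the positive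
excursion mass loses `R^{25/48}`; the saving is boundary two-leg non-intersection, or the positive
mesoscopic variant through `σ = 0` masses and the `5/8` boundary calibration). -/
def RootDominance : Prop :=
  ∀ (D : DobrushinDomain) (ρ : ℝ) (Λ Λ' : ℝ → Finset HexVertex) (m : ℝ → ℤ) (a : ℝ → Sym2 HexVertex),
    0 < ρ →
    D.carrier ∩ Metric.ball (D.pt 0) ρ = {z : ℂ | (D.pt 0).im < z.im} ∩ Metric.ball (D.pt 0) ρ →
    (∀ᶠ δ : ℝ in 𝓝[>] 0,
      hexDomainSimplyConnected (Λ δ) ∧ hexDomainSimplyConnected (Λ' δ) ∧ Λ' δ ⊆ Λ δ ∧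
      a δ ∈ hexDomainBoundary (Λ δ) ∧ a δ ∈ hexDomainBoundary (Λ' δ) ∧
      (∀ v ∈ Λ δ, (δ : ℂ) * hexCenter v ∈ D.carrier) ∧
      (∀ v : HexVertex, (δ : ℂ) * hexCenter v ∈ Metric.ball (D.pt 0) ρ → (v ∈ Λ δ ↔ m δ ≤ v.1 1)) ∧
      (∀ v : HexVertex, (δ : ℂ) * hexCenter v ∈ Metric.ball (D.pt 0) ρ → (v ∈ Λ' δ ↔ v ∈ Λ δ))) →
    Tendsto (fun δ : ℝ => (δ : ℂ) * hexMidpoint (a δ)) (𝓝[>] 0) (𝓝 (D.pt 0)) →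
    ∀ ε : ℝ, 0 < ε → ∃ r₀ : ℝ, 0 < r₀ ∧ ∀ r : ℝ, 0 < r → r < r₀ →
      ∃ ψ : ℂ → ℝ, Continuous ψ ∧ HasCompactSupport ψ ∧ (∀ z, 0 ≤ ψ z) ∧ (∃ z, ψ z ≠ 0) ∧
        tsupport ψ ⊆ Metric.ball (D.pt 0 + (r : ℂ) * Complex.I) (r / 4) ∧
        ∀ᶠ δ : ℝ in 𝓝[>] 0,
          ‖(∑ᶠ e ∈ hexDomainMidEdges (Λ' δ), (ψ ((δ : ℂ) * hexMidpoint e) : ℂ) *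
                hexParafermionicObservable (Λ' δ) (a δ) hexCriticalFugacity (5 / 8) e) -
              ∑ᶠ e ∈ hexDomainMidEdges (Λ δ), (ψ ((δ : ℂ) * hexMidpoint e) : ℂ) *
                hexParafermionicObservable (Λ δ) (a δ) hexCriticalFugacity (5 / 8) e‖ ≤
            ε * ‖∑ᶠ e ∈ hexDomainMidEdges (Λ δ), (ψ ((δ : ℂ) * hexMidpoint e) : ℂ) *
                hexParafermionicObservable (Λ δ) (a δ) hexCriticalFugacity (5 / 8) e‖

/-- STATEMENT 3's conclusion — `HexAvoidanceCocycle` (the restriction formula for the critical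
hexagonal SAW WITH ITS VALUE, canonical law): in the flat-boundary class, for every hull subdomain
`D'` of `D` (`MarkedDomain.IsHullSubdomain`: Jordan, same marks, `D ∖ D'` away from both marks) and any
chordal SLE_{8/3} law `μ` of `D`, `P_δ[γ_δ ⊆ closure D'] → μ {range ⊆ closure D'}` (`= Φ_A'(0)^{5/8}`
by [LSW] Thm 6.1 transposed, `IsSLELaw.hullRestriction_eightThirds_holds` /
`sle_restriction_eightThirds_holds`). Implied by the crux (portmanteau; the touching event is
`μ`-null), so not a strengthening; it is hypothesis H1/PFR of the summit cards
`hyperspace-capacity-connectedness` / `excursion-cocycle-five-eighths`, here DERIVED. -/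
def HexAvoidanceCocycle : Prop :=
  ∀ (D D' : DobrushinDomain) (ρ : ℝ) (a b : ℝ → HexVertex) (μ : Measure (CurveClass ℂ)),
    0 < ρ →
    (∀ i : Fin 2, D.carrier ∩ Metric.ball (D.pt i) ρ = {z : ℂ | (D.pt i).im < z.im} ∩ Metric.ball (D.pt i) ρ) →
    IsEmbEndpointApprox hexGraph hexCenter D a b →
    (∀ᶠ δ : ℝ in 𝓝[>] 0,
      (a δ ∈ embMeshDomain hexGraph hexCenter D.carrier δ ∧
        ∃ w, hexGraph.Adj (a δ) w ∧ ¬ (hexDomainGraph D.carrier δ).Adj (a δ) w) ∧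
      (b δ ∈ embMeshDomain hexGraph hexCenter D.carrier δ ∧
        ∃ w, hexGraph.Adj (b δ) w ∧ ¬ (hexDomainGraph D.carrier δ).Adj (b δ) w)) →
    D.IsHullSubdomain D' → IsSLELaw ((8 : ℝ≥0) / 3) D μ →
    Tendsto (fun δ : ℝ =>
        ((hexSAWLaw D.carrier δ (a δ) (b δ)).map
            (fun γ : HexDomainSAW D.carrier δ (a δ) (b δ) => γ.curve))
          (CurveClass.rangeSubset (closure D'.carrier)))
      (𝓝[>] 0) (𝓝 (μ (CurveClass.rangeSubset (closure D'.carrier))))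

/-- STATEMENT 3 — `AvoidanceCocycleFromObservable`: statements 1 and 2 give the cocycle. -/
def AvoidanceCocycleFromObservable : Prop :=
  ObservableLimit → RootDominance → HexAvoidanceCocycle

/-- STATEMENT 4's conclusion — `HexRangeLimit`: in the flat-boundary class the RANGE of the walk, a
random point of the hyperspace `NonemptyCompacts ℂ` (Hausdorff metric = Vietoris topology), converges
in law (`TendstoLaw`, portmanteau form) to the range of a chordal SLE_{8/3} curve of `D`. -/
def HexRangeLimit : Prop :=
  ∀ (D : DobrushinDomain) (ρ : ℝ) (a b : ℝ → HexVertex),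
    0 < ρ →
    (∀ i : Fin 2, D.carrier ∩ Metric.ball (D.pt i) ρ = {z : ℂ | (D.pt i).im < z.im} ∩ Metric.ball (D.pt i) ρ) →
    IsEmbEndpointApprox hexGraph hexCenter D a b →
    (∀ᶠ δ : ℝ in 𝓝[>] 0,
      (a δ ∈ embMeshDomain hexGraph hexCenter D.carrier δ ∧
        ∃ w, hexGraph.Adj (a δ) w ∧ ¬ (hexDomainGraph D.carrier δ).Adj (a δ) w) ∧
      (b δ ∈ embMeshDomain hexGraph hexCenter D.carrier δ ∧
        ∃ w, hexGraph.Adj (b δ) w ∧ ¬ (hexDomainGraph D.carrier δ).Adj (b δ) w)) →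
    ∃ Γ : (ℝ≥0 → ℝ) → CurveClass ℂ, IsSLECurve ((8 : ℝ≥0) / 3) D Γ ∧
      TendstoLaw
        (fun δ (γ : HexDomainSAW D.carrier δ (a δ) (b δ)) =>
          (⟨⟨γ.curve.range, γ.curve.isCompact_range⟩, γ.curve.range_nonempty⟩ :
            TopologicalSpace.NonemptyCompacts ℂ))
        (fun δ => hexSAWLaw D.carrier δ (a δ) (b δ))
        (fun ω => (⟨⟨(Γ ω).range, (Γ ω).isCompact_range⟩, (Γ ω).range_nonempty⟩ :
            TopologicalSpace.NonemptyCompacts ℂ))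
        Literature.Probability.Process.preWienerMeasure

/-- STATEMENT 4 — `RangeIdentification`: the avoidance cocycle identifies the range. -/
def RangeIdentification : Prop :=
  HexAvoidanceCocycle → HexRangeLimit

/-- STATEMENT 5 — `HexNonRetracing` (the ONE regularity input): in the flat-boundary class, for every
`ℓ > 0` and `η > 0` there is `ε > 0` with, eventually as `δ → 0⁺`,
`P_δ[γ_δ has an (ε, ℓ)-triple strand] ≤ η`. -/
def HexNonRetracing : Prop :=
  ∀ (D : DobrushinDomain) (ρ : ℝ) (a b : ℝ → HexVertex),
    0 < ρ →
    (∀ i : Fin 2, D.carrier ∩ Metric.ball (D.pt i) ρ = {z : ℂ | (D.pt i).im < z.im} ∩ Metric.ball (D.pt i) ρ) →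
    IsEmbEndpointApprox hexGraph hexCenter D a b →
    (∀ᶠ δ : ℝ in 𝓝[>] 0,
      (a δ ∈ embMeshDomain hexGraph hexCenter D.carrier δ ∧
        ∃ w, hexGraph.Adj (a δ) w ∧ ¬ (hexDomainGraph D.carrier δ).Adj (a δ) w) ∧
      (b δ ∈ embMeshDomain hexGraph hexCenter D.carrier δ ∧
        ∃ w, hexGraph.Adj (b δ) w ∧ ¬ (hexDomainGraph D.carrier δ).Adj (b δ) w)) →
    ∀ ℓ : ℝ, 0 < ℓ → ∀ η : ℝ, 0 < η → ∃ ε : ℝ, 0 < ε ∧ ∀ᶠ δ : ℝ in 𝓝[>] 0,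
      hexSAWLaw D.carrier δ (a δ) (b δ)
          {γ | ∃ c : Curve ℂ, CurveClass.mk c = γ.curve ∧ ∃ s t : Fin 3 → unitInterval,
            (∀ i, s i ≤ t i) ∧ t 0 < s 1 ∧ t 1 < s 2 ∧
            (∀ i, ℓ ≤ Metric.diam ((⇑c) '' Set.Icc (s i) (t i))) ∧
            ∀ i j, Metric.hausdorffDist ((⇑c) '' Set.Icc (s i) (t i))
              ((⇑c) '' Set.Icc (s j) (t j)) ≤ ε} ≤ ENNReal.ofReal η

/-- STATEMENT 6 — `CurveUpgrade` (ABSTRACT, all curve families; deterministic topology + portmanteau):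
if `Γ` is a chordal SLE_{8/3} curve of `D`, the interfaces `X δ` are eventually a.e.-measurable, their
RANGES converge in law to the range of `Γ`, their endpoints are deterministic (`src δ`, `tgt δ`) and
tend to the marks, and triple strands die in law (`ε → 0` after `δ → 0`), then `X δ → SLE_{8/3}` in law
in `CurveClass ℂ`. Mechanism: the SLE_{8/3} trace is a.s. a simple arc `η` from `a` to `b`; a curve
whose range is Hausdorff-`ε`-close to `η`, with the right endpoints and NO parameter backtrack of size
`h` (measured through the nearest-point projection to `η`, well defined up to the injectivity modulus
`ω_η(2ε)`), is within `osc_η(h + 2ω_η(2ε)) + ε` of `η` modulo reparametrisation; and an `h`-backtrack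
forces three passes over `η[u, u+h]`, i.e. an `(ε', ℓ')`-triple strand with `ε' = 2ε + 2 osc_η(ω_η(2ε))`,
`ℓ' = diam η[u,u+h] − ε'`; tightness in `CurveClass` and identification of every subsequential limit
follow (the range of the limit has the law of the SLE range, a simple arc a.s.; a non-retracing curve
onto a simple arc with source `a` is that arc). -/
def CurveUpgrade : Prop :=
  ∀ (D : DobrushinDomain) (Ω : ℝ → Type) [∀ δ, MeasurableSpace (Ω δ)]
    (X : ∀ δ, Ω δ → CurveClass ℂ) (P : ∀ δ, Measure (Ω δ))
    (Γ : (ℝ≥0 → ℝ) → CurveClass ℂ) (src tgt : ℝ → ℂ),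
    IsSLECurve ((8 : ℝ≥0) / 3) D Γ →
    (∀ᶠ δ : ℝ in 𝓝[>] 0, AEMeasurable (X δ) (P δ)) →
    TendstoLaw
        (fun δ ω => (⟨⟨(X δ ω).range, (X δ ω).isCompact_range⟩, (X δ ω).range_nonempty⟩ :
            TopologicalSpace.NonemptyCompacts ℂ))
        P
        (fun ω => (⟨⟨(Γ ω).range, (Γ ω).isCompact_range⟩, (Γ ω).range_nonempty⟩ :
            TopologicalSpace.NonemptyCompacts ℂ))
        Literature.Probability.Process.preWienerMeasure →
    (∀ δ ω, (X δ ω).source = src δ) → (∀ δ ω, (X δ ω).target = tgt δ) →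
    Tendsto src (𝓝[>] 0) (𝓝 (D.pt 0)) → Tendsto tgt (𝓝[>] 0) (𝓝 (D.pt 1)) →
    (∀ ℓ : ℝ, 0 < ℓ → ∀ η : ℝ, 0 < η → ∃ ε : ℝ, 0 < ε ∧ ∀ᶠ δ : ℝ in 𝓝[>] 0,
      P δ {ω | ∃ c : Curve ℂ, CurveClass.mk c = X δ ω ∧ ∃ s t : Fin 3 → unitInterval,
            (∀ i, s i ≤ t i) ∧ t 0 < s 1 ∧ t 1 < s 2 ∧
            (∀ i, ℓ ≤ Metric.diam ((⇑c) '' Set.Icc (s i) (t i))) ∧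
            ∀ i j, Metric.hausdorffDist ((⇑c) '' Set.Icc (s i) (t i))
              ((⇑c) '' Set.Icc (s j) (t j)) ≤ ε} ≤ ENNReal.ofReal η) →
    ConvergesInLawToSLE ((8 : ℝ≥0) / 3) D X P

/-- STATEMENT 7's hypothesis — `HexConjectureFlatBoundary`: the crux restricted to the flat-boundary
class (flat horizontal pieces at both marks; discrete-boundary lattice endpoints). This is what stubs
1–6 deliver (`hexConjectureFlatBoundary_of_line`). -/
def HexConjectureFlatBoundary : Prop :=
  ∀ (D : DobrushinDomain) (ρ : ℝ) (a b : ℝ → HexVertex),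
    0 < ρ →
    (∀ i : Fin 2, D.carrier ∩ Metric.ball (D.pt i) ρ = {z : ℂ | (D.pt i).im < z.im} ∩ Metric.ball (D.pt i) ρ) →
    IsEmbEndpointApprox hexGraph hexCenter D a b →
    (∀ᶠ δ : ℝ in 𝓝[>] 0,
      (a δ ∈ embMeshDomain hexGraph hexCenter D.carrier δ ∧
        ∃ w, hexGraph.Adj (a δ) w ∧ ¬ (hexDomainGraph D.carrier δ).Adj (a δ) w) ∧
      (b δ ∈ embMeshDomain hexGraph hexCenter D.carrier δ ∧
        ∃ w, hexGraph.Adj (b δ) w ∧ ¬ (hexDomainGraph D.carrier δ).Adj (b δ) w)) →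
    ConvergesInLawToSLE ((8 : ℝ≥0) / 3) D
      (fun δ (γ : HexDomainSAW D.carrier δ (a δ) (b δ)) => γ.curve)
      (fun δ => hexSAWLaw D.carrier δ (a δ) (b δ))

/-- STATEMENT 7 — `MarksAndEndpoints` (FOREIGN residual): the flat-boundary class suffices. -/
def MarksAndEndpoints : Prop :=
  HexConjectureFlatBoundary → Summit.CriticalPhenomena.SAWScalingLimit.Theses.SAWHexUniversality.HexConjecture

/-! ## The registered stubs (`sorry` lives only here; signatures verbatim and fully qualified, so that a
Theorems-side `propose --supports stmt-CriticalPhenomena-0808` proof can restate them textually) -/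

/-- **STUB 1 · `stub_observableLimit`** (XL, OPEN since 2010; SHARED — it is the route target
stmt-CriticalPhenomena-14003 `HexObservableLimitR` verbatim, wanted by SAWDefectDecoherence and, as
the repaired Conj. 2, the common target of the four observable routes; NOT this line's to attack).
DCS 2012 Conjecture 2 on the honeycomb lattice, `ψ`-averaged against bulk test functions and
normalised at one boundary mid-edge `b_δ`, both marks pinned conformally (horizontal half-plane pieces,
exact half-lattice `{row ≥ m_i(δ)}` in the `ρ`-balls): `δ²⟨ψ, F_δ⟩/F_δ(b_δ) → c ∫ ψ e^{(5/8)(L − L_b)}`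
with one universal `c ≠ 0`. Why it might fail / status: needs BOTH halves of discrete Cauchy–Riemann
(barrier `ParafermionicHalfCauchyRiemann`); the corridor witness that refuted stmt-5420 is excluded by
the rigid ball at `a` (refuter notes on 14003, 2026-08-16). The line uses it TWICE (in `Ω` and in the
hull subdomain `Ω'`, which is again flat-pinned with a smaller `ρ`). [arXiv:1007.0575 Conj. 2;
Smirnov ICM 2006/2010] -/
theorem stub_observableLimit : ∃ c : ℂ, c ≠ 0 ∧ ∀ (D : Literature.Probability.RandomPlanarGeometry.DobrushinDomain) (ρ : ℝ) (Λ : ℝ → Finset Literature.Probability.LatticeModels.HexVertex) (m : Fin 2 → ℝ → ℤ) (a b : ℝ → Sym2 Literature.Probability.LatticeModels.HexVertex) (Φ : Literature.Probability.RandomPlanarGeometry.ConformalEquiv D.carrier UpperHalfPlane.upperHalfPlaneSet) (L : ℂ → ℂ) (Lb : ℂ) (ψ : ℂ → ℂ), let F : ℝ → Sym2 Literature.Probability.LatticeModels.HexVertex → ℂ := fun δ z => Literature.Probability.RandomPlanarGeometry.SAW.hexParafermionicObservable (Λ δ) (a δ) Literature.Probability.RandomPlanarGeometry.SAW.hexCriticalFugacity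 (5 / 8) z; 0 < ρ → (∀ i : Fin 2, D.carrier ∩ Metric.ball (D.pt i) ρ = {z : ℂ | (D.pt i).im < z.im} ∩ Metric.ball (D.pt i) ρ) → (∀ᶠ δ : ℝ in nhdsWithin 0 (Set.Ioi 0), Literature.Probability.RandomPlanarGeometry.SAW.hexDomainSimplyConnected (Λ δ) ∧ a δ ∈ Literature.Probability.RandomPlanarGeometry.SAW.hexDomainBoundary (Λ δ) ∧ b δ ∈ Literature.Probability.RandomPlanarGeometry.SAW.hexDomainBoundary (Λ δ) ∧ Nonempty (Literature.Probability.RandomPlanarGeometry.SAW.HexMidEdgeSAW (Λ δ) (a δ) (b δ)) ∧ (Literature.Probability.LatticeModels.hexGraph.induce ((Λ δ : Finset Literature.Probability.LatticeModels.HexVertex) : Set Literature.Probability.LatticeModels.HexVertex)).Preconnected ∧ (∀ v ∈ Λ δ, (δ : ℂ) * Literature.Probability.LatticeModels.hexCenter v ∈ D.carrier) ∧ (∀ i : Fin 2, ∀ v : Literature.Probability.LatticeModels.HexVertex, (δ : ℂ) * Literature.Probability.LatticeModels.hexCenter v ∈ Metric.ball (D.pt i) ρ → (v ∈ Λ δ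 ↔ m i δ ≤ v.1 1))) → (∀ K : Set ℂ, IsCompact K → K ⊆ D.carrier → ∀ᶠ δ : ℝ in nhdsWithin 0 (Set.Ioi 0), ∀ v : Literature.Probability.LatticeModels.HexVertex, (δ : ℂ) * Literature.Probability.LatticeModels.hexCenter v ∈ K → v ∈ Λ δ) → Filter.Tendsto (fun δ : ℝ => (δ : ℂ) * Literature.Probability.RandomPlanarGeometry.SAW.hexMidpoint (a δ)) (nhdsWithin 0 (Set.Ioi 0)) (nhds (D.pt 0)) → Filter.Tendsto (fun δ : ℝ => (δ : ℂ) * Literature.Probability.RandomPlanarGeometry.SAW.hexMidpoint (b δ)) (nhdsWithin 0 (Set.Ioi 0)) (nhds (D.pt 1)) → Filter.Tendsto (fun x => ‖Φ x‖) (nhdsWithin (D.pt 0) D.carrier) Filter.atTop → Φ.HasBoundaryValue (D.pt 1) 0 → ContinuousOn L D.carrier → (∀ z ∈ D.carrier, Complex.exp (L z) = deriv Φ z) → Filter.Tendsto L (nhdsWithin (D.pt 1) D.carrier) (nhds Lb) → Continuous ψ → HasCompactSupport ψ → tsupport ψ ⊆ D.carrier → Filter.Tendsto (fun δ : ℝ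 => (δ : ℂ) ^ 2 * (∑ᶠ e ∈ Literature.Probability.RandomPlanarGeometry.SAW.hexDomainMidEdges (Λ δ), ψ ((δ : ℂ) * Literature.Probability.RandomPlanarGeometry.SAW.hexMidpoint e) * F δ e) / F δ (b δ)) (nhdsWithin 0 (Set.Ioi 0)) (nhds (c * ∫ z, ψ z * Complex.exp ((5 / 8 : ℂ) * (L z - Lb)))) := by
  sorry

/-- **STUB 2 · `stub_rootDominance`** (L–XL, OPEN — THE LEVER; hardest stub of the line; the lead holds
this one). ROOT DOMINANCE, see `RootDominance`. WHY PLAUSIBLY TRUE: `F(a δ) = 1` pins both observables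
at the common root (`hexParafermionicObservable_self`); near `a` both are governed by the same
half-plane problem (same rigid half-lattice in `B(a, ρ)`), the far geometry entering only through
walks that travel from scale `r` to scale `ρ` and back (boundary two-leg cost `(r/ρ)^{2}`-type) — in
continuum language `F_{Ω'} ≈ F_Ω` near the root because `φ_{Ω'} = h ∘ φ_Ω` with `h(w) = λ w + O(1)` at
`∞` and the ABSOLUTE normalisation of `F` is fixed at the root (this is the scalar stmt-14003 cannot
see; `c_{Ω'} λ^{5/8} = c_Ω`). Given STUB 1 in `Ω` and `Ω'` it is EQUIVALENT to the cocycle with the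
LSW value (Kennedy's simulations, arXiv:math/0112246, support the value to `< 1%`). WHY IT MIGHT FAIL /
WHY HARD: it carries phase content — `|F(e)| ≪ Z(e)` in the bulk by `R^{-25/48}` (`R = r/δ`), so the
crude bound `‖S' − S‖ ≤ Σ ψ · (mass of walks a → e via A)` loses `R^{25/48} → ∞`; a proof is either a
decoherence estimate for the `A`-touching sub-ensemble near the root (the route's `DefectDecoherence`
engine applied to a difference of two fields with the same boundary data near `a`), or the POSITIVE
mesoscopic variant (`σ = 0` masses: `Z_{Λ'}(a,z)/Z_Λ(a,z) → 1` for boundary mid-edges `z` near the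
root by the complex sum rule `Σ_{z≠a} e^{i(3/8)Θ} Z(a,z) = e^{3πi/8}` in the tame half-disc +
half-plane bridge decay, Krachun–Panagiotis arXiv:2310.17299 Thm 2 / Lemma 2.2, then the `5/8`
boundary calibration near the root, the same information `BoundaryClosureR` stmt-14004 must produce).
Uses the rigid half-lattice at the root (honours the corridor witness of stmt-5420). Leans on:
`hexParafermionicObservable`, `hexParafermionicObservable_self`, `DuminilCopinSmirnov2012_lemma1_holds`,
`norm_hexParafermionicObservable_le`, route supports `BoundaryWindingRigidity` (stmt-8515),
`StaggeredSumRule` (stmt-8516). [arXiv:1007.0575 Lemma 1–2; arXiv:2310.17299; arXiv:math/0112246] -/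
theorem stub_rootDominance : ∀ (D : Literature.Probability.RandomPlanarGeometry.DobrushinDomain) (ρ : ℝ) (Λ Λ' : ℝ → Finset Literature.Probability.LatticeModels.HexVertex) (m : ℝ → ℤ) (a : ℝ → Sym2 Literature.Probability.LatticeModels.HexVertex), 0 < ρ → D.carrier ∩ Metric.ball (D.pt 0) ρ = {z : ℂ | (D.pt 0).im < z.im} ∩ Metric.ball (D.pt 0) ρ → (∀ᶠ δ : ℝ in nhdsWithin (0 : ℝ) (Set.Ioi 0), Literature.Probability.RandomPlanarGeometry.SAW.hexDomainSimplyConnected (Λ δ) ∧ Literature.Probability.RandomPlanarGeometry.SAW.hexDomainSimplyConnected (Λ' δ) ∧ Λ' δ ⊆ Λ δ ∧ a δ ∈ Literature.Probability.RandomPlanarGeometry.SAW.hexDomainBoundary (Λ δ) ∧ a δ ∈ Literature.Probability.RandomPlanarGeometry.SAW.hexDomainBoundary (Λ' δ) ∧ (∀ v ∈ Λ δ, (δ : ℂ) * Literature.Probability.LatticeModels.hexCenter v ∈ D.carrier) ∧ (∀ v : Literature.Probability.LatticeModels.HexVertex, (δ : ℂ) * Literature.Probability.LatticeModels.hexCenter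 v ∈ Metric.ball (D.pt 0) ρ → (v ∈ Λ δ ↔ m δ ≤ v.1 1)) ∧ (∀ v : Literature.Probability.LatticeModels.HexVertex, (δ : ℂ) * Literature.Probability.LatticeModels.hexCenter v ∈ Metric.ball (D.pt 0) ρ → (v ∈ Λ' δ ↔ v ∈ Λ δ))) → Filter.Tendsto (fun δ : ℝ => (δ : ℂ) * Literature.Probability.RandomPlanarGeometry.SAW.hexMidpoint (a δ)) (nhdsWithin (0 : ℝ) (Set.Ioi 0)) (nhds (D.pt 0)) → ∀ ε : ℝ, 0 < ε → ∃ r₀ : ℝ, 0 < r₀ ∧ ∀ r : ℝ, 0 < r → r < r₀ → ∃ ψ : ℂ → ℝ, Continuous ψ ∧ HasCompactSupport ψ ∧ (∀ z, 0 ≤ ψ z) ∧ (∃ z, ψ z ≠ 0) ∧ tsupport ψ ⊆ Metric.ball (D.pt 0 + (r : ℂ) * Complex.I) (r / 4) ∧ ∀ᶠ δ : ℝ in nhdsWithin (0 : ℝ) (Set.Ioi 0), ‖(∑ᶠ e ∈ Literature.Probability.RandomPlanarGeometry.SAW.hexDomainMidEdges (Λ' δ), (ψ ((δ : ℂ) *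 Literature.Probability.RandomPlanarGeometry.SAW.hexMidpoint e) : ℂ) * Literature.Probability.RandomPlanarGeometry.SAW.hexParafermionicObservable (Λ' δ) (a δ) Literature.Probability.RandomPlanarGeometry.SAW.hexCriticalFugacity (5 / 8) e) - ∑ᶠ e ∈ Literature.Probability.RandomPlanarGeometry.SAW.hexDomainMidEdges (Λ δ), (ψ ((δ : ℂ) * Literature.Probability.RandomPlanarGeometry.SAW.hexMidpoint e) : ℂ) * Literature.Probability.RandomPlanarGeometry.SAW.hexParafermionicObservable (Λ δ) (a δ) Literature.Probability.RandomPlanarGeometry.SAW.hexCriticalFugacity (5 / 8) e‖ ≤ ε * ‖∑ᶠ e ∈ Literature.Probability.RandomPlanarGeometry.SAW.hexDomainMidEdges (Λ δ), (ψ ((δ : ℂ) * Literature.Probability.RandomPlanarGeometry.SAW.hexMidpoint e) : ℂ) * Literature.Probability.RandomPlanarGeometry.SAW.hexParafermionicObservable (Λ δ) (a δ) Literature.Probability.RandomPlanarGeometry.SAW.hexCriticalFugacity (5 / 8) e‖ := by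
  sorry

/-- **STUB 3 · `stub_avoidanceCocycle`** (L; provable GIVEN its two antecedents — analysis +
combinatorics, no new SAW estimate): STUB 1 → STUB 2 → `HexAvoidanceCocycle`. THE WORK. (a) Exact
lattice restriction: for vertex sets `Λ' ⊆ Λ` the `x_c`-SAWs of `Λ` from `a` to `b` staying in `Λ'`
ARE the SAWs of `Λ'`, so `P_Λ(γ ⊆ Λ') = Z_{Λ'}(a,b)/Z_Λ(a,b) = F'(b)/F(b)` (`|F(b)| = Z(b)` and equal
phases by winding rigidity at the boundary mid-edge `b`, route support stmt-8515). (b) The computation: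
with STUB 1 in `(Ω, Λ)` and in `(Ω', Λ')` (a hull subdomain of a flat-pinned domain is flat-pinned with
a smaller `ρ`; `Λ'` := `Λ` cut down to `Ω'`, filled to be hex-simply-connected) and STUB 2's bumps
`ψ_r`: `F'(b)/F(b) = (S'/S)·(δ²S/F(b))/(δ²S'/F'(b)) → (1 ± ε)·I_Ω(ψ_r)/I_{Ω'}(ψ_r)`, and
`I_{Ω'}(ψ)/I_Ω(ψ) → (h'(∞)/h'(0))^{5/8}` as `r → 0` (`φ_{Ω'} = h∘φ_Ω`, `L' − L'_b = L − L_b +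
log h'(φ_Ω) − log h'(0)`, `h'(φ_Ω(z)) → h'(∞)` on `supp ψ_r`, `|I_Ω(ψ_r)| ≥ cos(5π/32)·∫ψ_r|e^{(5/8)(L−L_b)}|`
by the angular localisation of `ψ_r`); so `lim P = (h'(0)/h'(∞))^{5/8} = Φ_Ã'(0)^{5/8}` (`Ã = φ_Ω(A)`,
bounded and away from `0`; inversion-symmetric, no SLE reversibility needed). (c) The value is
`μ(rangeSubset (closure D'))`: [LSW] Thm 6.1 in `ℍ` (`sle_restriction_eightThirds_holds`, value
`ENNReal.ofReal (d^{5/8})`, `d = Φ_A'(0)`) transported by a chordal uniformiser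
(`MarkedDomain.exists_isChordalUniformizing_holds`, `disjoint_range_pullbackHull_iff`, the touching
event is null: `HullRestrictionNull`). (d) Canonical transfer (flat-boundary class): `Ω_δ` =
`embMeshDomain` with mesh edges; in the flat balls it is the half-lattice `{row ≥ m}` or that plus a row
of DANGLING degree-1 down-faces (never visited except as endpoints: forced first/last step, `O(δ)` in
`CurveClass`); a discrete-boundary endpoint is a bottom up-face / dangling face, i.e. the walk is the
mid-edge walk from the boundary mid-edge below it (weights `x_c^{#vertices}` agree); away from the
marks `Λ δ :=` the hex-simply-connected filling of `V(Ω_δ)` is admissible for STUB 1, and the walks of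
`Λ δ` that are not walks of `Ω_δ` (a non-mesh honeycomb edge, a filled bulb) pass within `δ` of
`∂Ω` at distance `≥ ρ/2` from the marks — their fraction `→ 0` by the cocycle itself for thin
two-sided collar hulls (value `→ 1`), likewise the `O(δ²)`-boundary discrepancy between
`{range ⊆ closure D'}` and `{vertices in Ω'}` (sandwich between shrunk/enlarged hulls, continuity of
`Φ'_A(0)` in `A`: `HasRestrictionDeriv.tendsto_of_kernel_holds`). Probability eventually:
`IsEmbEndpointApprox.reachable` (honours `hexConjecture_false_without_reachable`). Leans on: STUB 1,
STUB 2, `hexParafermionicObservable_zero_spin`, `hexSAWWeight_singleton`, `embDomainGraph_adj_iff`,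
`embMeshGraph_adj_iff`, `sle_restriction_eightThirds_holds`, `IsSLELaw.hullRestriction_eightThirds_holds`,
`MarkedDomain.IsHullSubdomain.eventually_mem`, `exists_isSLECurve_eightThirds`, `IsSLECurve.map_eq_holds`.
[arXiv:math/0209343 Thm 6.1; arXiv:1007.0575 §3; LSW 2004 SAW §3.4] -/
theorem stub_avoidanceCocycle : (∃ c : ℂ, c ≠ 0 ∧ ∀ (D : Literature.Probability.RandomPlanarGeometry.DobrushinDomain) (ρ : ℝ) (Λ : ℝ → Finset Literature.Probability.LatticeModels.HexVertex) (m : Fin 2 → ℝ → ℤ) (a b : ℝ → Sym2 Literature.Probability.LatticeModels.HexVertex) (Φ : Literature.Probability.RandomPlanarGeometry.ConformalEquiv D.carrier UpperHalfPlane.upperHalfPlaneSet) (L : ℂ → ℂ) (Lb : ℂ) (ψ : ℂ → ℂ), let F : ℝ → Sym2 Literature.Probability.LatticeModels.HexVertex → ℂ := fun δ z => Literature.Probability.RandomPlanarGeometry.SAW.hexParafermionicObservable (Λ δ) (a δ) Literature.Probability.RandomPlanarGeometry.SAW.hexCriticalFugacity (5 / 8) z; 0 < ρ → (∀ i : Fin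 2, D.carrier ∩ Metric.ball (D.pt i) ρ = {z : ℂ | (D.pt i).im < z.im} ∩ Metric.ball (D.pt i) ρ) → (∀ᶠ δ : ℝ in nhdsWithin 0 (Set.Ioi 0), Literature.Probability.RandomPlanarGeometry.SAW.hexDomainSimplyConnected (Λ δ) ∧ a δ ∈ Literature.Probability.RandomPlanarGeometry.SAW.hexDomainBoundary (Λ δ) ∧ b δ ∈ Literature.Probability.RandomPlanarGeometry.SAW.hexDomainBoundary (Λ δ) ∧ Nonempty (Literature.Probability.RandomPlanarGeometry.SAW.HexMidEdgeSAW (Λ δ) (a δ) (b δ)) ∧ (Literature.Probability.LatticeModels.hexGraph.induce ((Λ δ : Finset Literature.Probability.LatticeModels.HexVertex) : Set Literature.Probability.LatticeModels.HexVertex)).Preconnected ∧ (∀ v ∈ Λ δ, (δ : ℂ) * Literature.Probability.LatticeModels.hexCenter v ∈ D.carrier) ∧ (∀ i : Fin 2, ∀ v : Literature.Probability.LatticeModels.HexVertex, (δ : ℂ) * Literature.Probability.LatticeModels.hexCenter v ∈ Metric.ball (D.pt i) ρ → (v ∈ Λ δ ↔ m i δ ≤ v.1 1))) → (∀ K : Set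 ℂ, IsCompact K → K ⊆ D.carrier → ∀ᶠ δ : ℝ in nhdsWithin 0 (Set.Ioi 0), ∀ v : Literature.Probability.LatticeModels.HexVertex, (δ : ℂ) * Literature.Probability.LatticeModels.hexCenter v ∈ K → v ∈ Λ δ) → Filter.Tendsto (fun δ : ℝ => (δ : ℂ) * Literature.Probability.RandomPlanarGeometry.SAW.hexMidpoint (a δ)) (nhdsWithin 0 (Set.Ioi 0)) (nhds (D.pt 0)) → Filter.Tendsto (fun δ : ℝ => (δ : ℂ) * Literature.Probability.RandomPlanarGeometry.SAW.hexMidpoint (b δ)) (nhdsWithin 0 (Set.Ioi 0)) (nhds (D.pt 1)) → Filter.Tendsto (fun x => ‖Φ x‖) (nhdsWithin (D.pt 0) D.carrier) Filter.atTop → Φ.HasBoundaryValue (D.pt 1) 0 → ContinuousOn L D.carrier → (∀ z ∈ D.carrier, Complex.exp (L z) = deriv Φ z) → Filter.Tendsto L (nhdsWithin (D.pt 1) D.carrier) (nhds Lb) → Continuous ψ → HasCompactSupport ψ → tsupport ψ ⊆ D.carrier → Filter.Tendsto (fun δ : ℝ => (δ : ℂ) ^ 2 * (∑ᶠ e ∈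 Literature.Probability.RandomPlanarGeometry.SAW.hexDomainMidEdges (Λ δ), ψ ((δ : ℂ) * Literature.Probability.RandomPlanarGeometry.SAW.hexMidpoint e) * F δ e) / F δ (b δ)) (nhdsWithin 0 (Set.Ioi 0)) (nhds (c * ∫ z, ψ z * Complex.exp ((5 / 8 : ℂ) * (L z - Lb))))) → (∀ (D : Literature.Probability.RandomPlanarGeometry.DobrushinDomain) (ρ : ℝ) (Λ Λ' : ℝ → Finset Literature.Probability.LatticeModels.HexVertex) (m : ℝ → ℤ) (a : ℝ → Sym2 Literature.Probability.LatticeModels.HexVertex), 0 < ρ → D.carrier ∩ Metric.ball (D.pt 0) ρ = {z : ℂ | (D.pt 0).im < z.im} ∩ Metric.ball (D.pt 0) ρ → (∀ᶠ δ : ℝ in nhdsWithin (0 : ℝ) (Set.Ioi 0), Literature.Probability.RandomPlanarGeometry.SAW.hexDomainSimplyConnected (Λ δ) ∧ Literature.Probability.RandomPlanarGeometry.SAW.hexDomainSimplyConnected (Λ' δ) ∧ Λ' δ ⊆ Λ δ ∧ a δ ∈ Literature.Probability.RandomPlanarGeometry.SAW.hexDomainBoundary (Λ δ) ∧ a δ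 ∈ Literature.Probability.RandomPlanarGeometry.SAW.hexDomainBoundary (Λ' δ) ∧ (∀ v ∈ Λ δ, (δ : ℂ) * Literature.Probability.LatticeModels.hexCenter v ∈ D.carrier) ∧ (∀ v : Literature.Probability.LatticeModels.HexVertex, (δ : ℂ) * Literature.Probability.LatticeModels.hexCenter v ∈ Metric.ball (D.pt 0) ρ → (v ∈ Λ δ ↔ m δ ≤ v.1 1)) ∧ (∀ v : Literature.Probability.LatticeModels.HexVertex, (δ : ℂ) * Literature.Probability.LatticeModels.hexCenter v ∈ Metric.ball (D.pt 0) ρ → (v ∈ Λ' δ ↔ v ∈ Λ δ))) → Filter.Tendsto (fun δ : ℝ => (δ : ℂ) * Literature.Probability.RandomPlanarGeometry.SAW.hexMidpoint (a δ)) (nhdsWithin (0 : ℝ) (Set.Ioi 0)) (nhds (D.pt 0)) → ∀ ε : ℝ, 0 < ε → ∃ r₀ : ℝ, 0 < r₀ ∧ ∀ r : ℝ, 0 < r → r < r₀ → ∃ ψ : ℂ → ℝ, Continuous ψ ∧ HasCompactSupport ψ ∧ (∀ z, 0 ≤ ψ z) ∧ (∃ z, ψ z ≠ 0) ∧ tsupport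 ψ ⊆ Metric.ball (D.pt 0 + (r : ℂ) * Complex.I) (r / 4) ∧ ∀ᶠ δ : ℝ in nhdsWithin (0 : ℝ) (Set.Ioi 0), ‖(∑ᶠ e ∈ Literature.Probability.RandomPlanarGeometry.SAW.hexDomainMidEdges (Λ' δ), (ψ ((δ : ℂ) * Literature.Probability.RandomPlanarGeometry.SAW.hexMidpoint e) : ℂ) * Literature.Probability.RandomPlanarGeometry.SAW.hexParafermionicObservable (Λ' δ) (a δ) Literature.Probability.RandomPlanarGeometry.SAW.hexCriticalFugacity (5 / 8) e) - ∑ᶠ e ∈ Literature.Probability.RandomPlanarGeometry.SAW.hexDomainMidEdges (Λ δ), (ψ ((δ : ℂ) * Literature.Probability.RandomPlanarGeometry.SAW.hexMidpoint e) : ℂ) * Literature.Probability.RandomPlanarGeometry.SAW.hexParafermionicObservable (Λ δ) (a δ) Literature.Probability.RandomPlanarGeometry.SAW.hexCriticalFugacity (5 / 8) e‖ ≤ ε * ‖∑ᶠ e ∈ Literature.Probability.RandomPlanarGeometry.SAW.hexDomainMidEdges (Λ δ), (ψ ((δ : ℂ) * Literature.Probability.RandomPlanarGeometry.SAW.hexMidpoint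 e) : ℂ) * Literature.Probability.RandomPlanarGeometry.SAW.hexParafermionicObservable (Λ δ) (a δ) Literature.Probability.RandomPlanarGeometry.SAW.hexCriticalFugacity (5 / 8) e‖) → ∀ (D D' : Literature.Probability.RandomPlanarGeometry.DobrushinDomain) (ρ : ℝ) (a b : ℝ → Literature.Probability.LatticeModels.HexVertex) (μ : MeasureTheory.Measure (Literature.Probability.RandomPlanarGeometry.CurveClass ℂ)), 0 < ρ → (∀ i : Fin 2, D.carrier ∩ Metric.ball (D.pt i) ρ = {z : ℂ | (D.pt i).im < z.im} ∩ Metric.ball (D.pt i) ρ) → Literature.Probability.RandomPlanarGeometry.SAW.IsEmbEndpointApprox Literature.Probability.LatticeModels.hexGraph Literature.Probability.LatticeModels.hexCenter D a b → (∀ᶠ δ : ℝ in nhdsWithin (0 : ℝ) (Set.Ioi 0), (a δ ∈ Literature.Probability.RandomPlanarGeometry.SAW.embMeshDomain Literature.Probability.LatticeModels.hexGraph Literature.Probability.LatticeModels.hexCenter D.carrier δ ∧ ∃ w, Literature.Probability.LatticeModels.hexGraph.Adj (a δ) w ∧ ¬ (Literature.Probability.RandomPlanarGeometry.SAW.hexDomainGraph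 D.carrier δ).Adj (a δ) w) ∧ (b δ ∈ Literature.Probability.RandomPlanarGeometry.SAW.embMeshDomain Literature.Probability.LatticeModels.hexGraph Literature.Probability.LatticeModels.hexCenter D.carrier δ ∧ ∃ w, Literature.Probability.LatticeModels.hexGraph.Adj (b δ) w ∧ ¬ (Literature.Probability.RandomPlanarGeometry.SAW.hexDomainGraph D.carrier δ).Adj (b δ) w)) → D.IsHullSubdomain D' → Literature.Probability.RandomPlanarGeometry.IsSLELaw ((8 : NNReal) / 3) D μ → Filter.Tendsto (fun δ : ℝ => ((Literature.Probability.RandomPlanarGeometry.SAW.hexSAWLaw D.carrier δ (a δ) (b δ)).map (fun γ : Literature.Probability.RandomPlanarGeometry.SAW.HexDomainSAW D.carrier δ (a δ) (b δ) => γ.curve)) (Literature.Probability.RandomPlanarGeometry.CurveClass.rangeSubset (closure D'.carrier))) (nhdsWithin (0 : ℝ) (Set.Ioi 0)) (nhds (μ (Literature.Probability.RandomPlanarGeometry.CurveClass.rangeSubset (closure D'.carrier)))) := by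
  sorry

/-- **STUB 4 · `stub_rangeIdentification`** (M–L, PROVABLE NOW — soft: measure theory + plane topology
+ the tree's restriction library): `HexAvoidanceCocycle → HexRangeLimit`. THE WORK. The laws of
`K_δ := range γ_δ ⊆ closure D` live in the compact hyperspace `{K ⊆ closure D}` of `NonemptyCompacts ℂ`
(Mathlib `NonemptyCompacts.instMetricSpace`, Blaschke), so they are relatively compact — NO tightness
estimate. Let `ν` be a subsequential limit and `μ` the SLE_{8/3} law of `D` (`exists_isSLECurve_eightThirds`).
(i) `ν{K ⊆ closure D'} = μ{range ⊆ closure D'}` for every hull subdomain `D'`: portmanteau on the closed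
event (`NonemptyCompacts.isClosed_subsets_of_isClosed`) and on its interior, sandwiching `D'` between
shrunk and enlarged hulls, the values being continuous (`HasRestrictionDeriv.tendsto_of_kernel_holds`; or
directly `μ`-continuity). (ii) These events are a π-system rich enough ([LSW] Lemma 3.2:
`RestrictionConfig.isPiSystem_avoid_holds`, `ext_of_avoid_holds`, `IsRestrictionMeasure.unique`, after
pulling back by a chordal uniformiser `MarkedDomain.exists_isChordalUniformizing_holds`) to determine
the law of the boundary-visible hull `H(K) := closure D ∖ ⋃{components of closure D ∖ K reaching
∂D ∖ {a,b}}`; hence `H(K)` under `ν` has the law of `H(range Γ) = range Γ` (the SLE_{8/3} trace is a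
simple arc meeting `∂D` only at the marks: `sleEightThirdsFamily_spec`,
`ae_isSimpleTrace_sleTrace_eightThirds_of_hasSLETrace hasSLETrace_eightThirds`). (iii) `K ⊆ H(K)`, `K` is connected and contains `a`, `b` (closed conditions,
limits of connected polylines with endpoints `→ a, b`), and a connected subset of a simple arc
containing both its endpoints is the arc: `K = H(K)` `ν`-a.s. So every subsequential limit is the law of
`range Γ`; compactness gives `TendstoLaw`. Probability measures eventually from `reachable`
(`isProbabilityMeasure_hexSAWLaw`; finiteness of `Ω_δ`); `isProjectiveLimit_preWienerMeasure_holds` for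
the target. Leans on: the cocycle (STUB 3), `CurveClass.isClosed_rangeSubset`,
`Literature.MeasureTheory.RandomSets.AvoidanceFunctional` (π-systems of avoidance events, Borel =
Effros), `RestrictionMeasuresProofs`, `HullRestrictionSLEHolds`, `SLEUniquenessInLaw`.
[arXiv:math/0209343 Lemma 3.2, Prop. 3.3, Thm 6.1; Matheron 1975 (Choquet–Kendall–Matheron)] -/
theorem stub_rangeIdentification : (∀ (D D' : Literature.Probability.RandomPlanarGeometry.DobrushinDomain) (ρ : ℝ) (a b : ℝ → Literature.Probability.LatticeModels.HexVertex) (μ : MeasureTheory.Measure (Literature.Probability.RandomPlanarGeometry.CurveClass ℂ)), 0 < ρ → (∀ i : Fin 2, D.carrier ∩ Metric.ball (D.pt i) ρ = {z : ℂ | (D.pt i).im < z.im} ∩ Metric.ball (D.pt i) ρ) → Literature.Probability.RandomPlanarGeometry.SAW.IsEmbEndpointApprox Literature.Probability.LatticeModels.hexGraph Literature.Probability.LatticeModels.hexCenter D a b → (∀ᶠ δ : ℝ in nhdsWithin (0 : ℝ) (Set.Ioi 0), (a δ ∈ Literature.Probability.RandomPlanarGeometry.SAW.embMeshDomain Literature.Probability.LatticeModels.hexGraph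 Literature.Probability.LatticeModels.hexCenter D.carrier δ ∧ ∃ w, Literature.Probability.LatticeModels.hexGraph.Adj (a δ) w ∧ ¬ (Literature.Probability.RandomPlanarGeometry.SAW.hexDomainGraph D.carrier δ).Adj (a δ) w) ∧ (b δ ∈ Literature.Probability.RandomPlanarGeometry.SAW.embMeshDomain Literature.Probability.LatticeModels.hexGraph Literature.Probability.LatticeModels.hexCenter D.carrier δ ∧ ∃ w, Literature.Probability.LatticeModels.hexGraph.Adj (b δ) w ∧ ¬ (Literature.Probability.RandomPlanarGeometry.SAW.hexDomainGraph D.carrier δ).Adj (b δ) w)) → D.IsHullSubdomain D' → Literature.Probability.RandomPlanarGeometry.IsSLELaw ((8 : NNReal) / 3) D μ → Filter.Tendsto (fun δ : ℝ => ((Literature.Probability.RandomPlanarGeometry.SAW.hexSAWLaw D.carrier δ (a δ) (b δ)).map (fun γ : Literature.Probability.RandomPlanarGeometry.SAW.HexDomainSAW D.carrier δ (a δ) (b δ) => γ.curve)) (Literature.Probability.RandomPlanarGeometry.CurveClass.rangeSubset (closure D'.carrier))) (nhdsWithin (0 : ℝ) (Set.Ioi 0)) (nhds (μ (Literature.Probability.RandomPlanarGeometry.CurveClass.rangeSubset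 (closure D'.carrier))))) → ∀ (D : Literature.Probability.RandomPlanarGeometry.DobrushinDomain) (ρ : ℝ) (a b : ℝ → Literature.Probability.LatticeModels.HexVertex), 0 < ρ → (∀ i : Fin 2, D.carrier ∩ Metric.ball (D.pt i) ρ = {z : ℂ | (D.pt i).im < z.im} ∩ Metric.ball (D.pt i) ρ) → Literature.Probability.RandomPlanarGeometry.SAW.IsEmbEndpointApprox Literature.Probability.LatticeModels.hexGraph Literature.Probability.LatticeModels.hexCenter D a b → (∀ᶠ δ : ℝ in nhdsWithin (0 : ℝ) (Set.Ioi 0), (a δ ∈ Literature.Probability.RandomPlanarGeometry.SAW.embMeshDomain Literature.Probability.LatticeModels.hexGraph Literature.Probability.LatticeModels.hexCenter D.carrier δ ∧ ∃ w, Literature.Probability.LatticeModels.hexGraph.Adj (a δ) w ∧ ¬ (Literature.Probability.RandomPlanarGeometry.SAW.hexDomainGraph D.carrier δ).Adj (a δ) w) ∧ (b δ ∈ Literature.Probability.RandomPlanarGeometry.SAW.embMeshDomain Literature.Probability.LatticeModels.hexGraph Literature.Probability.LatticeModels.hexCenter D.carrier δ ∧ ∃ w, Literature.Probability.LatticeModels.hexGraph.Adj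 (b δ) w ∧ ¬ (Literature.Probability.RandomPlanarGeometry.SAW.hexDomainGraph D.carrier δ).Adj (b δ) w)) → ∃ Γ : (NNReal → ℝ) → Literature.Probability.RandomPlanarGeometry.CurveClass ℂ, Literature.Probability.RandomPlanarGeometry.IsSLECurve ((8 : NNReal) / 3) D Γ ∧ Literature.Probability.RandomPlanarGeometry.TendstoLaw (fun δ (γ : Literature.Probability.RandomPlanarGeometry.SAW.HexDomainSAW D.carrier δ (a δ) (b δ)) => (⟨⟨γ.curve.range, γ.curve.isCompact_range⟩, γ.curve.range_nonempty⟩ : TopologicalSpace.NonemptyCompacts ℂ)) (fun δ => Literature.Probability.RandomPlanarGeometry.SAW.hexSAWLaw D.carrier δ (a δ) (b δ)) (fun ω => (⟨⟨(Γ ω).range, (Γ ω).isCompact_range⟩, (Γ ω).range_nonempty⟩ : TopologicalSpace.NonemptyCompacts ℂ)) Literature.Probability.Process.preWienerMeasure := by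
  sorry

/-- **STUB 5 · `stub_nonRetracing`** (L–XL, OPEN — the line's one SAW regularity estimate; second
hardest): `HexNonRetracing` — in the flat-boundary class, for `ℓ, η > 0` there is `ε > 0` with
`P_δ[(ε, ℓ)-triple strand] ≤ η` eventually. WHY PLAUSIBLY TRUE: implied by the crux (a curve uniformly
close to a simple arc has no triple strand below the arc's injectivity modulus); heuristically three
disjoint strands pairwise `ε`-close over diameter `ℓ` cost `exp(−c ℓ/ε)` (each `ε`-box crossed three
times lengthwise; the `x_c`-SAW in a strip of width `W` has correlation length `≍ W`). MECHANISM ON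
OFFER: cover the three strands by a chain of `≍ ℓ/ε` boxes of side `3ε`; in each box three disjoint
lengthwise crossings, each an irreducible bridge of width `W = ε/δ` whose `x_c`-mass is `≤ B_W → 0`
(DCS Lemma 2: `B_T(x_c) ≤ 1`; Krachun–Panagiotis 2023 Thm 2: `B_T → 0`), against the entropy `C^{ℓ/ε}`
of box chains: mass `≤ (C B_W³)^{ℓ/ε}`. WHY IT MIGHT FAIL: the bound is on MASSES; turning it into a
PROBABILITY needs a lower bound on `Z(a_δ → b_δ)` or a quasi-multiplicativity `Z(a→b) ≳ Z(a→u)Z(u→b)`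
— the missing "RSW for SAW" (`n = 0`: no FKG; KS17 covers FK/percolation/LERW only); and KP's decay has
no rate. Weaker than `HexTight` (stmt-5423) only modulo range convergence; standalone it is a
six-arm-in-a-thin-tube bound. Eventual form (not the refuted all-`δ` stmt-0772). Leans on:
`hexSAWLaw`, `EmbDomainSAW.curve`, `DuminilCopinSmirnov2012_thm1`, bridge decompositions
(`Literature…SelfAvoidingWalk`), [arXiv:1007.0575 Lemma 2; arXiv:2310.17299 Thm 2, Lemma 2.2;
Duminil-Copin–Hammond CMP 2013; Kemppainen–Smirnov arXiv:1212.6215 §4]. -/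
theorem stub_nonRetracing : ∀ (D : Literature.Probability.RandomPlanarGeometry.DobrushinDomain) (ρ : ℝ) (a b : ℝ → Literature.Probability.LatticeModels.HexVertex), 0 < ρ → (∀ i : Fin 2, D.carrier ∩ Metric.ball (D.pt i) ρ = {z : ℂ | (D.pt i).im < z.im} ∩ Metric.ball (D.pt i) ρ) → Literature.Probability.RandomPlanarGeometry.SAW.IsEmbEndpointApprox Literature.Probability.LatticeModels.hexGraph Literature.Probability.LatticeModels.hexCenter D a b → (∀ᶠ δ : ℝ in nhdsWithin (0 : ℝ) (Set.Ioi 0), (a δ ∈ Literature.Probability.RandomPlanarGeometry.SAW.embMeshDomain Literature.Probability.LatticeModels.hexGraph Literature.Probability.LatticeModels.hexCenter D.carrier δ ∧ ∃ w, Literature.Probability.LatticeModels.hexGraph.Adj (a δ) w ∧ ¬ (Literature.Probability.RandomPlanarGeometry.SAW.hexDomainGraph D.carrier δ).Adj (a δ) w) ∧ (b δ ∈ Literature.Probability.RandomPlanarGeometry.SAW.embMeshDomain Literature.Probability.LatticeModels.hexGraph Literature.Probability.LatticeModels.hexCenter D.carrier δ ∧ ∃ w, Literature.Probability.LatticeModels.hexGraph.Adj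 (b δ) w ∧ ¬ (Literature.Probability.RandomPlanarGeometry.SAW.hexDomainGraph D.carrier δ).Adj (b δ) w)) → ∀ ℓ : ℝ, 0 < ℓ → ∀ η : ℝ, 0 < η → ∃ ε : ℝ, 0 < ε ∧ ∀ᶠ δ : ℝ in nhdsWithin (0 : ℝ) (Set.Ioi 0), Literature.Probability.RandomPlanarGeometry.SAW.hexSAWLaw D.carrier δ (a δ) (b δ) {γ | ∃ c : Literature.Probability.RandomPlanarGeometry.Curve ℂ, Literature.Probability.RandomPlanarGeometry.CurveClass.mk c = γ.curve ∧ ∃ s t : Fin 3 → unitInterval, (∀ i, s i ≤ t i) ∧ t 0 < s 1 ∧ t 1 < s 2 ∧ (∀ i, ℓ ≤ Metric.diam ((⇑c) '' Set.Icc (s i) (t i))) ∧ ∀ i j, Metric.hausdorffDist ((⇑c) '' Set.Icc (s i) (t i)) ((⇑c) '' Set.Icc (s j) (t j)) ≤ ε} ≤ ENNReal.ofReal η := by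
  sorry

/-- **STUB 6 · `stub_curveUpgrade`** (M, PROVABLE NOW — deterministic plane topology + portmanteau; no
SAW input): `CurveUpgrade`, see its docstring for the mechanism. Inputs from the tree: the SLE_{8/3}
curve is a.s. simple with endpoints `pt 0`, `pt 1` (`Negative.IsSLECurve.ae_source_eq/ae_target_eq`,
`ae_isSimpleTrace_sleTrace_eightThirds_of_hasSLETrace hasSLETrace_eightThirds`, `IsCompactifiedImage`),
`CurveClass` is Polish (`CurveClass.instPolishSpace`), `range : CurveClass → NonemptyCompacts` is
1-Lipschitz (`Curve.infDist_range_le`), `isProjectiveLimit_preWienerMeasure_holds`. Steps: (1) the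
deterministic lemma (module docstring); (2) tightness of `law(X δ)` in `CurveClass ℂ` from (1) + the
hypotheses (Aizenman–Burchard compactness criterion = bounded number of `h`-steps, inherited from the
arc); (3) every subsequential limit `ν`: ranges have the law of `range Γ`, no triple strands a.s.
(`{triple strand (ε,ℓ)} ⊆ interior {triple strand (2ε, ℓ/2)}`, portmanteau), source `= pt 0`; a
non-retracing curve onto a simple arc from its source is that arc, and the law of a simple curve class
is the image of the law of its (range, source) under a measurable map — so `ν = law Γ`. Why it might
need reshaping: only measurability bookkeeping (arcs form an analytic set; work on the coupling space or
with `MeasureTheory.AnalyticSet`). [Aizenman–Burchard Duke 1999 §2; Billingsley 1999 Thm 2.1, §5] -/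
theorem stub_curveUpgrade : ∀ (D : Literature.Probability.RandomPlanarGeometry.DobrushinDomain) (Ω : ℝ → Type) [∀ δ, MeasurableSpace (Ω δ)] (X : ∀ δ, Ω δ → Literature.Probability.RandomPlanarGeometry.CurveClass ℂ) (P : ∀ δ, MeasureTheory.Measure (Ω δ)) (Γ : (NNReal → ℝ) → Literature.Probability.RandomPlanarGeometry.CurveClass ℂ) (src tgt : ℝ → ℂ), Literature.Probability.RandomPlanarGeometry.IsSLECurve ((8 : NNReal) / 3) D Γ → (∀ᶠ δ : ℝ in nhdsWithin (0 : ℝ) (Set.Ioi 0), AEMeasurable (X δ) (P δ)) → Literature.Probability.RandomPlanarGeometry.TendstoLaw (fun δ ω => (⟨⟨(X δ ω).range, (X δ ω).isCompact_range⟩, (X δ ω).range_nonempty⟩ : TopologicalSpace.NonemptyCompacts ℂ)) P (fun ω => (⟨⟨(Γ ω).range, (Γ ω).isCompact_range⟩, (Γ ω).range_nonempty⟩ : TopologicalSpace.NonemptyCompacts ℂ)) Literature.Probability.Process.preWienerMeasure → (∀ δ ω, (X δ ω).source = src δ) → (∀ δ ω, (X δ ω).target = tgt δ) → Filter.Tendsto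 src (nhdsWithin (0 : ℝ) (Set.Ioi 0)) (nhds (D.pt 0)) → Filter.Tendsto tgt (nhdsWithin (0 : ℝ) (Set.Ioi 0)) (nhds (D.pt 1)) → (∀ ℓ : ℝ, 0 < ℓ → ∀ η : ℝ, 0 < η → ∃ ε : ℝ, 0 < ε ∧ ∀ᶠ δ : ℝ in nhdsWithin (0 : ℝ) (Set.Ioi 0), P δ {ω | ∃ c : Literature.Probability.RandomPlanarGeometry.Curve ℂ, Literature.Probability.RandomPlanarGeometry.CurveClass.mk c = X δ ω ∧ ∃ s t : Fin 3 → unitInterval, (∀ i, s i ≤ t i) ∧ t 0 < s 1 ∧ t 1 < s 2 ∧ (∀ i, ℓ ≤ Metric.diam ((⇑c) '' Set.Icc (s i) (t i))) ∧ ∀ i j, Metric.hausdorffDist ((⇑c) '' Set.Icc (s i) (t i)) ((⇑c) '' Set.Icc (s j) (t j)) ≤ ε} ≤ ENNReal.ofReal η) → Literature.Probability.RandomPlanarGeometry.ConvergesInLawToSLE ((8 : NNReal) / 3) D X P := by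
  sorry

/-- **STUB 7 · `stub_marksAndEndpoints`** (XL, OPEN, FOREIGN — not attacked by this line; recorded so
that the composition is honest about ALL Dobrushin domains and ALL endpoint approximations):
`HexConjectureFlatBoundary → HexConjecture`. CONTENT = two residuals shared by every observable route
(disprover's N2; `ObservableToSLER` stmt-14005 owes the same): (R2) ENDPOINT UNIVERSALITY — the crux
allows any `a δ, b δ` with `δ·a δ → a`, joined in `Ω_δ` (microscopically interior endpoints at lattice
distance `→ ∞`, `o(1)` macroscopically), strictly more than DCS's printed boundary vertices
(`Boundary.boundaryEndpoints_of_hexConjecture` is the trivial direction; this stub contains its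
converse); partial mechanism: endpoints at bounded lattice distance from the boundary by local surgery
(finitely many patterns, each a boundary-rooted ensemble of a notched admissible domain); (R1) ROUGH
MARKS — conformal invariance of the limit at marked prime ends that are not flat (corners, generic
Jordan points); NO mechanism on file (restriction cannot move the marks: hull subdomains agree with the
domain near `a`, `b`; pinching hulls have `Φ' = 0`). WHY PLAUSIBLY TRUE: both sides are believed
(DCS Conj. 1 as printed is for all simply connected `Ω`); no junk family known: the flat-boundary class
is non-vacuous (rectangle with both marks on the bottom side, bottom-row endpoints;
`Boundary.isEmbEndpointApprox_unitDisc_boundary` pattern). RECOMMENDED to the tenure planner: this is the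
seam along which the crux item should eventually be split (this file types both halves and the glue). -/
theorem stub_marksAndEndpoints : (∀ (D : Literature.Probability.RandomPlanarGeometry.DobrushinDomain) (ρ : ℝ) (a b : ℝ → Literature.Probability.LatticeModels.HexVertex), 0 < ρ → (∀ i : Fin 2, D.carrier ∩ Metric.ball (D.pt i) ρ = {z : ℂ | (D.pt i).im < z.im} ∩ Metric.ball (D.pt i) ρ) → Literature.Probability.RandomPlanarGeometry.SAW.IsEmbEndpointApprox Literature.Probability.LatticeModels.hexGraph Literature.Probability.LatticeModels.hexCenter D a b → (∀ᶠ δ : ℝ in nhdsWithin (0 : ℝ) (Set.Ioi 0), (a δ ∈ Literature.Probability.RandomPlanarGeometry.SAW.embMeshDomain Literature.Probability.LatticeModels.hexGraph Literature.Probability.LatticeModels.hexCenter D.carrier δ ∧ ∃ w, Literature.Probability.LatticeModels.hexGraph.Adj (a δ) w ∧ ¬ (Literature.Probability.RandomPlanarGeometry.SAW.hexDomainGraph D.carrier δ).Adj (a δ) w) ∧ (b δ ∈ Literature.Probability.RandomPlanarGeometry.SAW.embMeshDomain Literature.Probability.LatticeModels.hexGraph Literature.Probability.LatticeModels.hexCenter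 D.carrier δ ∧ ∃ w, Literature.Probability.LatticeModels.hexGraph.Adj (b δ) w ∧ ¬ (Literature.Probability.RandomPlanarGeometry.SAW.hexDomainGraph D.carrier δ).Adj (b δ) w)) → Literature.Probability.RandomPlanarGeometry.ConvergesInLawToSLE ((8 : NNReal) / 3) D (fun δ (γ : Literature.Probability.RandomPlanarGeometry.SAW.HexDomainSAW D.carrier δ (a δ) (b δ)) => γ.curve) (fun δ => Literature.Probability.RandomPlanarGeometry.SAW.hexSAWLaw D.carrier δ (a δ) (b δ))) → ∀ (D : Literature.Probability.RandomPlanarGeometry.DobrushinDomain) (a b : ℝ → Literature.Probability.LatticeModels.HexVertex), Literature.Probability.RandomPlanarGeometry.SAW.IsEmbEndpointApprox Literature.Probability.LatticeModels.hexGraph Literature.Probability.LatticeModels.hexCenter D a b → Literature.Probability.RandomPlanarGeometry.ConvergesInLawToSLE ((8 : NNReal) / 3) D (fun δ (γ : Literature.Probability.RandomPlanarGeometry.SAW.HexDomainSAW D.carrier δ (a δ) (b δ)) => γ.curve) (fun δ => Literature.Probability.RandomPlanarGeometry.SAW.hexSAWLaw D.carrier δ (a δ) (b δ)) := by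
  sorry

/-! ## Consistency: each named statement IS its registered stub (definitionally) -/

theorem observableLimit_holds : ObservableLimit := stub_observableLimit
theorem rootDominance_holds : RootDominance := stub_rootDominance
theorem avoidanceCocycleFromObservable_holds : AvoidanceCocycleFromObservable := stub_avoidanceCocycle
theorem rangeIdentification_holds : RangeIdentification := stub_rangeIdentification
theorem hexNonRetracing_holds : HexNonRetracing := stub_nonRetracing
theorem curveUpgrade_holds : CurveUpgrade := stub_curveUpgrade
theorem marksAndEndpoints_holds : MarksAndEndpoints := stub_marksAndEndpoints

/-- The crux decl is statement 7's conclusion (definitionally). -/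
theorem marksAndEndpoints_iff :
    MarksAndEndpoints ↔ (HexConjectureFlatBoundary → Summit.CriticalPhenomena.SAWScalingLimit.Theses.SAWHexUniversality.HexConjecture) :=
  Iff.rfl

/-! ## Name-keyed aliases of the seven statements (the hypotheses of the composition) -/
namespace Registered

/-- Alias of `ObservableLimit` keyed by the registered stub name. -/
abbrev stub_observableLimit : Prop := ObservableLimit
/-- Alias of `RootDominance` keyed by the registered stub name. -/
abbrev stub_rootDominance : Prop := RootDominance
/-- Alias of `AvoidanceCocycleFromObservable` keyed by the registered stub name. -/
abbrev stub_avoidanceCocycle : Prop := AvoidanceCocycleFromObservable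
/-- Alias of `RangeIdentification` keyed by the registered stub name. -/
abbrev stub_rangeIdentification : Prop := RangeIdentification
/-- Alias of `HexNonRetracing` keyed by the registered stub name. -/
abbrev stub_nonRetracing : Prop := HexNonRetracing
/-- Alias of `CurveUpgrade` keyed by the registered stub name. -/
abbrev stub_curveUpgrade : Prop := CurveUpgrade
/-- Alias of `MarksAndEndpoints` keyed by the registered stub name. -/
abbrev stub_marksAndEndpoints : Prop := MarksAndEndpoints

end Registered

/-! ## Proved glue -/

/-- The polyline of a lattice SAW starts at its embedded first vertex. -/
theorem curve_source_eq {Ω : Set ℂ} {δ : ℝ} {u v : HexVertex} (γ : HexDomainSAW Ω δ u v) :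
    γ.curve.source = (δ : ℂ) * hexCenter u :=
  SimpleGraph.Walk.toCurve_apply_zero _ _

/-- The polyline of a lattice SAW ends at its embedded last vertex. -/
theorem curve_target_eq {Ω : Set ℂ} {δ : ℝ} {u v : HexVertex} (γ : HexDomainSAW Ω δ u v) :
    γ.curve.target = (δ : ℂ) * hexCenter v :=
  SimpleGraph.Walk.toCurve_apply_one _ _

/-- THE REACH OF THE LINE WITHOUT THE FOREIGN STUB (kernel-checked): statements 1–6 give the crux on
the flat-boundary class. Range identification is fed by the cocycle (statements 1, 2 through 3), the
curve upgrade by the range limit, the deterministic endpoints of the lattice polylines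
(`curve_source_eq/target_eq` with `IsEmbEndpointApprox.tendsto_fst/snd` — the two load-bearing clauses
of `Negative.hexConjecture_false_without_tendsto_fst/snd`), a.e.-measurability for the discrete
σ-algebra, and non-retracing. -/
theorem hexConjectureFlatBoundary_of_line (h1 : ObservableLimit) (h2 : RootDominance)
    (h3 : AvoidanceCocycleFromObservable) (h4 : RangeIdentification) (h5 : HexNonRetracing)
    (h6 : CurveUpgrade) : HexConjectureFlatBoundary := by
  intro D ρ a b hρ hflat happ hbd
  obtain ⟨Γ, hΓ, hrange⟩ := h4 (h3 h1 h2) D ρ a b hρ hflat happ hbd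
  exact h6 D (fun δ => HexDomainSAW D.carrier δ (a δ) (b δ)) (fun δ γ => γ.curve)
    (fun δ => hexSAWLaw D.carrier δ (a δ) (b δ)) Γ
    (fun δ => (δ : ℂ) * hexCenter (a δ)) (fun δ => (δ : ℂ) * hexCenter (b δ)) hΓ
    (Eventually.of_forall fun δ => (EmbDomainSAW.measurable_of_top _).aemeasurable) hrange
    (fun δ γ => curve_source_eq γ) (fun δ γ => curve_target_eq γ) happ.tendsto_fst happ.tendsto_snd
    (h5 D ρ a b hρ hflat happ hbd)

/-- The printed (discrete-boundary-endpoint) reading of the conjecture, the disprover's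
`Boundary.HexConjectureBoundaryEndpoints`, already contains this line's class: the foreign stub 7 is
(the flat-marks case of) the CONVERSE of `Boundary.boundaryEndpoints_of_hexConjecture`. -/
theorem flatBoundary_of_boundaryEndpoints
    (h : Summit.CriticalPhenomena.SAWScalingLimit.Cruxes.HexConjecture.Boundary.HexConjectureBoundaryEndpoints) :
    HexConjectureFlatBoundary :=
  fun D _ a b _ _ happ hbd => h D a b happ hbd

/-! ## The composition: the seven stubs imply the crux, by name -/

/-- `HexConjecture` from the seven stubs (pure logic; no `sorry`): stubs 1–6 give the flat-boundary
class (`hexConjectureFlatBoundary_of_line`), stub 7 passes to all Dobrushin domains and endpoint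
approximations. -/
theorem HexConjecture_of (h1 : Registered.stub_observableLimit) (h2 : Registered.stub_rootDominance)
    (h3 : Registered.stub_avoidanceCocycle) (h4 : Registered.stub_rangeIdentification)
    (h5 : Registered.stub_nonRetracing) (h6 : Registered.stub_curveUpgrade)
    (h7 : Registered.stub_marksAndEndpoints) :
    Summit.CriticalPhenomena.SAWScalingLimit.Theses.SAWHexUniversality.HexConjecture :=
  h7 (hexConjectureFlatBoundary_of_line h1 h2 h3 h4 h5 h6)

/-- The same composition concluding the decl of the payload's primary route `SAWDefectDecoherence`
(the shared item stmt-0808 is declared with the identical body in all four route files —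
`SAWHexUniversality`, `SAWBrickWallHomotopy`, `SAWResidueField`, `SAWDefectDecoherence` — so the four
decls are definitionally equal and this is the same term). -/
theorem HexConjecture_of' (h1 : Registered.stub_observableLimit) (h2 : Registered.stub_rootDominance)
    (h3 : Registered.stub_avoidanceCocycle) (h4 : Registered.stub_rangeIdentification)
    (h5 : Registered.stub_nonRetracing) (h6 : Registered.stub_curveUpgrade)
    (h7 : Registered.stub_marksAndEndpoints) :
    Summit.CriticalPhenomena.SAWScalingLimit.Theses.SAWDefectDecoherence.HexConjecture :=
  h7 (hexConjectureFlatBoundary_of_line h1 h2 h3 h4 h5 h6)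

/-- The two route decls of the shared crux are the same statement (definitionally). -/
theorem hexConjecture_iff : Summit.CriticalPhenomena.SAWScalingLimit.Theses.SAWHexUniversality.HexConjecture ↔ Summit.CriticalPhenomena.SAWScalingLimit.Theses.SAWDefectDecoherence.HexConjecture := Iff.rfl

/-- Wiring check / the skeleton audit's `<Crux>_proof` form: the registered stubs feed
`HexConjecture_of` as stated (closed modulo the `sorry`s inside the seven `stub_*`). -/
theorem HexConjecture_proof : Summit.CriticalPhenomena.SAWScalingLimit.Theses.SAWHexUniversality.HexConjecture :=
  HexConjecture_of stub_observableLimit stub_rootDominance stub_avoidanceCocycle stub_rangeIdentification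
    stub_nonRetracing stub_curveUpgrade stub_marksAndEndpoints

/-- Same, for the `SAWDefectDecoherence` decl. -/
theorem HexConjecture_proof' : Summit.CriticalPhenomena.SAWScalingLimit.Theses.SAWDefectDecoherence.HexConjecture :=
  HexConjecture_of' stub_observableLimit stub_rootDominance stub_avoidanceCocycle stub_rangeIdentification
    stub_nonRetracing stub_curveUpgrade stub_marksAndEndpoints

end Summit.CriticalPhenomena.SAWScalingLimit.Cruxes.HexConjecture.RootLocalityReplacesLoewner

end
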